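import Summits.NavierStokesRegularity.NavierStokesRegularity.Theses.AxisymmetricExtremality
import Literature.Analysis.FluidPDE.CKNTheoremB
import Literature.Analysis.FluidPDE.SereginEpsilonRegularityHolds
import Literature.Analysis.FluidPDE.SuitableWeakInBallTools
import Literature.Analysis.FluidPDE.LocalTypeIScaling
import Literature.Analysis.FluidPDE.SereginSverakPressureDecayBalls
import Literature.Analysis.FluidPDE.SuitableWeakStability
import HarnessLib

/-!
# Seregin 2022, §2 Step 1: partial regularity up to the top time — the backward-singular set of
# `𝒞 × ]-1, 0]` is `𝒫¹`-null —
# crux stmt-NavierStokesRegularity-15453 (`AxisymmetricExtremality.AxisymmetricKatoGlobal`), line registered, support for stub `stub_sereginLogSwirlOrigin`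

Support file (`--supports stmt-NavierStokesRegularity-15453`; theorems only, everything proved)
toward the registered stub `stub_sereginLogSwirlOrigin` = the named fact
`Literature.Analysis.FluidPDE.seregin2022_logSwirl_regularAtOrigin` (G. Seregin, J. Math. Fluid
Mech. 24 (2022), Paper 27 = arXiv:2201.00153, §2).  Step 1 of that proof (arXiv p. 5) starts:
"Since the 1D parabolic Hausdorff measure of the set of singular points is equal to zero, there
exist at least two regular points `z₁ = (0, h₁, 0)` and `z₂ = (0, -h₂, 0)` of `v` …".  The points
`zᵢ` lie on the TOP time `t = 0 ∉ Q = 𝒞 × ]-1, 0[`, so "regular" there is meant in the backward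
sense (`v ∈ L_∞(Q(zᵢ, δ))`), and the `𝒫¹`-nullity invoked is that of the BACKWARD-singular set of
`𝒞 × ]-1, 0]`, top time included — not the interior statement `ckn_partial_regularity`
(`singularSet u Q`, `Q` open, centred cylinders).  This file proves it for the hypothesis block of
the fact (Def. 1.1: suitable weak solution in `Q` with the global classes
`v ∈ L_{2,∞}(Q)`, `∇v ∈ L₂(Q)`, `q ∈ L_{3/2}(Q)`):

* `isParabolicNull_backwardSingular_top` (registered sub-goal) — the set of points
  `z = (t, x)`, `-1 < t ≤ 0`, `x ∈ 𝒞`, at which `v` is essentially unbounded on every backward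
  ball cylinder `Q_r(z)`, is `𝒫¹`-null.

Proof (Caffarelli–Kohn–Nirenberg 1982, §6, run with backward cylinders):
(1) `isSuitableWeakSolutionInBall_of_parCyl` — the Def.-1.1 class restricts to Albritton–Barker's
class on every ball cylinder `Q_ρ(z) ⊆ Q` (also for `t = 0`, where the closed box leaves `Q` and
only the GLOBAL classes serve); (2) `frequently_lt_dissipation_of_backwardSingular` — at a
backward-singular `z`, `ε/2 · r < ∫∫_{Q_r(z)} |∇v|²` for arbitrarily small `r`: otherwise
`E(r; z) ≤ ε/2` on a whole interval `]0, ρ[`, the zoom `v_ρ(s, y) = ρ v(t + ρ²s, x + ρy)`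
(`IsSuitableWeakSolutionInBall.zoom`, `cknE_nsZoom`) has `sup_{0<r<1} E(r) ≤ ε/2 < ε`, and the
backward ε-regularity criterion of Seregin 2014, Ch. 6, Thm. 1.4 (`seregin2014_thm14_holds`)
bounds `v_ρ` on some `Q_ϱ(0)`, i.e. `v` on `Q_{ρϱ}(z)` (`eLpNorm_top_nsZoom`); (3)
`isParabolicNull_of_frequently` — the Vitali covering estimate of the tree
(`parabolicHausdorff_one_le_of_frequently`, centred cylinders `Q*_r(z) ⊇ Q_r(z)`) for the
density `F = 𝟙_Q |∇v|² ∈ L¹(ℝ × ℝ³)` gives `𝒫¹(S) ≤ 10 ε⁻¹ ∫∫_V F` for every open `V ⊇ S`, hence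
`𝒫¹(S) < ∞`, `|S| = 0` (`volume_eq_zero_of_parabolicHausdorff_one_ne_top`), and `𝒫¹(S) = 0` by
outer regularity of Lebesgue measure and absolute continuity of `∫ F`.

## References

* G. Seregin, J. Math. Fluid Mech. 24 (2022), Paper No. 27 = arXiv:2201.00153, §2 Step 1 (arXiv
  p. 5), Def. 1.1. [`Seregin2022LocalAxisym`]
* L. Caffarelli, R. Kohn, L. Nirenberg, Comm. Pure Appl. Math. 35 (1982), §6 (Theorem B from
  Proposition 2, covering Lemma 6.1). [`CaffarelliKohnNirenberg1982`]
* G. Seregin, *Lecture Notes on Regularity Theory for the Navier–Stokes Equations*, World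
  Scientific 2014, Ch. 6, §6.1, Thm. 1.4. [`Seregin2014`]
* J. C. Robinson, J. L. Rodrigo, W. Sadowski, *The Three-Dimensional Navier–Stokes Equations*,
  CUP 2016, Thm. 16.2, (16.21). [`RobinsonRodrigoSadowski2016`]
-/

noncomputable section

open Set MeasureTheory Filter Topology Function Metric
open scoped ENNReal NNReal
open Literature.Analysis.FluidPDE

-- `<Problem> = <Summit>` duplicates a namespace component by design (lakefile sets the same option).
set_option linter.dupNamespace false

namespace Summit.NavierStokesRegularity.NavierStokesRegularity.Theorems.AxisymmetricKatoGlobal.EulerScaling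

/-! ### The covering step: concentration of an integrable density forces `𝒫¹`-nullity -/

/-- **`𝒫¹`-nullity from concentration of an integrable density** (Caffarelli–Kohn–Nirenberg
1982, §6, proof of Theorem B; Robinson–Rodrigo–Sadowski 2016, Thm. 16.2): if `F ∈ L¹(ℝ × ℝ³)`,
`F ≥ 0`, and every point `z ∈ Y` admits arbitrarily small radii `r` with
`l · r < ∫∫_{Q*_r(z)} F` (`0 < l < ∞`), then `𝒫¹(Y) = 0`: the covering estimate
`𝒫¹(Y) ≤ 5 l⁻¹ ∫∫_V F` for every open `V ⊇ Y` (`parabolicHausdorff_one_le_of_frequently`) gives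
`𝒫¹(Y) < ∞`, so `|Y| = 0`, so `Y` has open neighbourhoods of arbitrarily small `∫∫ F`.
[cite: CaffarelliKohnNirenberg1982, §6 (proof of Theorem B)] -/
theorem isParabolicNull_of_frequently {F : ℝ × EuclideanSpace ℝ (Fin 3) → ℝ≥0∞}
    (hF : ∫⁻ w, F w ≠ ∞) {Y : Set (ℝ × EuclideanSpace ℝ (Fin 3))} {l : ℝ≥0∞} (hl0 : l ≠ 0)
    (hlt : l ≠ ∞)
    (hY : ∀ z ∈ Y, ∃ᶠ r in 𝓝[>] (0 : ℝ),
      l * ENNReal.ofReal r < ∫⁻ w in parabolicCylinderCentered r z, F w) :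
    IsParabolicNull 1 Y := by
  have step : ∀ V : Set (ℝ × EuclideanSpace ℝ (Fin 3)), IsOpen V → Y ⊆ V →
      parabolicHausdorff 1 Y ≤ 5 * l⁻¹ * ∫⁻ w in V, F w := fun V hV hYV =>
    parabolicHausdorff_one_le_of_frequently hV hYV hl0 hlt hY
  have h5 : (5 : ℝ≥0∞) * l⁻¹ ≠ ∞ := ENNReal.mul_ne_top (by simp) (ENNReal.inv_ne_top.2 hl0)
  have hfin : parabolicHausdorff 1 Y ≠ ∞ := by
    refine ne_top_of_le_ne_top (ENNReal.mul_ne_top h5 hF) ?_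
    have h := step univ isOpen_univ (subset_univ _)
    rwa [Measure.restrict_univ] at h
  have hvol : volume Y = 0 := volume_eq_zero_of_parabolicHausdorff_one_ne_top hfin
  change parabolicHausdorff 1 Y = 0
  refine le_antisymm (ENNReal.le_of_forall_pos_le_add fun η hη _ => ?_) zero_le
  rw [zero_add]
  have h50 : (5 : ℝ≥0∞) * l⁻¹ ≠ 0 := mul_ne_zero (by norm_num) (ENNReal.inv_ne_zero.2 hlt)
  set η' : ℝ≥0∞ := ((5 : ℝ≥0∞) * l⁻¹)⁻¹ * η with hη'
  have hη'0 : η' ≠ 0 :=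
    mul_ne_zero (ENNReal.inv_ne_zero.2 h5) (ENNReal.coe_ne_zero.2 hη.ne')
  obtain ⟨θ, hθ0, hθ⟩ := exists_pos_setLIntegral_lt_of_measure_lt hF hη'0
  obtain ⟨U, hYU, hUo, hUθ⟩ := Set.exists_isOpen_lt_of_lt Y θ (by rw [hvol]; exact hθ0)
  calc parabolicHausdorff 1 Y ≤ 5 * l⁻¹ * ∫⁻ w in U, F w := step U hUo hYU
    _ ≤ 5 * l⁻¹ * η' := mul_le_mul' le_rfl (hθ U hUθ).le
    _ = η := by rw [hη', ← mul_assoc, ENNReal.mul_inv_cancel h50 h5, one_mul]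

/-! ### Geometry of `Q = 𝒞 × ]-1, 0[` near points of `𝒞 × ]-1, 0]` -/

/-- A ball cylinder `Q_ρ(z)` whose time window lies in `]-1, 0[` and whose ball lies in `𝒞` lies
in `Q = 𝒞 × ]-1, 0[`. [folklore] -/
theorem parabolicCylinder_subset_parCyl_of {z : ℝ × EuclideanSpace ℝ (Fin 3)} {ρ : ℝ}
    (hI : Ioo (z.1 - ρ ^ 2) z.1 ⊆ Ioo (-1 : ℝ) 0)
    (hB : ball z.2 ρ ⊆ SereginSverak2009.spaceCyl (0 : EuclideanSpace ℝ (Fin 3)) 1) :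
    parabolicCylinder ρ z ⊆ SereginSverak2009.parCyl 0 1 := by
  rintro ⟨t, x⟩ ⟨ht, hx⟩
  rw [SereginSverak2009.mem_parCyl]
  have ht' := hI ht
  have hx' := hB hx
  rw [SereginSverak2009.mem_spaceCyl] at hx'
  refine ⟨?_, hx'.1, hx'.2⟩
  simpa using ht'

/-- **Small backward cylinders at points of `𝒞 × ]-1, 0]` lie in `Q`**: for `-1 < t ≤ 0` and
`x ∈ 𝒞` (open), eventually along `ρ → 0⁺` the time window `]t - ρ², t[` lies in `]-1, 0[` and the
ball `B(x, ρ)` in `𝒞` — the top time `t = 0` included, backward cylinders looking only into the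
past. [cite: Seregin2022LocalAxisym, §2 Step 1 (arXiv:2201.00153 p. 5)] -/
theorem eventually_nhdsGT_window_ball_subset {z : ℝ × EuclideanSpace ℝ (Fin 3)}
    (hz1 : z.1 ∈ Ioc (-1 : ℝ) 0)
    (hz2 : z.2 ∈ SereginSverak2009.spaceCyl (0 : EuclideanSpace ℝ (Fin 3)) 1) :
    ∀ᶠ ρ in 𝓝[>] (0 : ℝ), 0 < ρ ∧ Ioo (z.1 - ρ ^ 2) z.1 ⊆ Ioo (-1 : ℝ) 0 ∧
      ball z.2 ρ ⊆ SereginSverak2009.spaceCyl (0 : EuclideanSpace ℝ (Fin 3)) 1 := by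
  obtain ⟨δ, hδ, hδsub⟩ := Metric.isOpen_iff.1 (SereginSverak2009.isOpen_spaceCyl 0 1) z.2 hz2
  have hpos : 0 < min δ (z.1 + 1) := lt_min hδ (by linarith [hz1.1])
  filter_upwards [Ioo_mem_nhdsGT hpos] with ρ hρ
  have hρδ : ρ < δ := hρ.2.trans_le (min_le_left _ _)
  have hρt : ρ < z.1 + 1 := hρ.2.trans_le (min_le_right _ _)
  have hρ1 : ρ ≤ 1 := by linarith [hz1.2]
  have hρsq : ρ ^ 2 ≤ ρ := by nlinarith [hρ.1]
  refine ⟨hρ.1, fun t ht => ⟨by linarith [ht.1], lt_of_lt_of_le ht.2 hz1.2⟩,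
    (ball_subset_ball hρδ.le).trans hδsub⟩

/-! ### The Def.-1.1 class in ball cylinders inside `Q` -/

/-- **The Def.-1.1 class restricts to Albritton–Barker's class on every ball cylinder `Q_ρ(z)`
with `]t - ρ², t[ ⊆ ]-1, 0[` and `B(x, ρ) ⊆ 𝒞`**, in particular at top-time centres `t = 0`
(where the closed box `[t - ρ², t] × B̄(x, ρ)` is NOT inside the open `Q`, so that the local
classes of `IsSuitableWeakSolutionOn` do not serve and the global classes of Def. 1.1 are used).
[cite: Seregin2022LocalAxisym, Def. 1.1 and §2 Step 1 (arXiv:2201.00153 p. 5)] -/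
theorem isSuitableWeakSolutionInBall_of_parCyl
    {v : ℝ → EuclideanSpace ℝ (Fin 3) → EuclideanSpace ℝ (Fin 3)} {q : ℝ → EuclideanSpace ℝ (Fin 3) → ℝ}
    {G : ℝ → EuclideanSpace ℝ (Fin 3) → EuclideanSpace ℝ (Fin 3) →L[ℝ] EuclideanSpace ℝ (Fin 3)}
    (hsw : IsSuitableWeakSolutionOn (SereginSverak2009.parCylOpens 0 1) 1 0 v q)
    (hA : ∃ C : ℝ≥0, ∀ᵐ t ∂(volume.restrict (Ioo (-1 : ℝ) 0)),
      ∫⁻ x in SereginSverak2009.spaceCyl 0 1, ‖v t x‖ₑ ^ 2 ≤ C)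
    (hG : HasWeakSpatialGradientOn (SereginSverak2009.parCylOpens 0 1) v G)
    (hE : ∫⁻ z in SereginSverak2009.parCyl 0 1, ENNReal.ofReal (frobeniusNormSq (G z.1 z.2)) < ∞)
    (hq : ∫⁻ z in SereginSverak2009.parCyl 0 1, ‖q z.1 z.2‖ₑ ^ (3 / 2 : ℝ) < ∞)
    {z : ℝ × EuclideanSpace ℝ (Fin 3)} {ρ : ℝ}
    (hI : Ioo (z.1 - ρ ^ 2) z.1 ⊆ Ioo (-1 : ℝ) 0)
    (hB : ball z.2 ρ ⊆ SereginSverak2009.spaceCyl (0 : EuclideanSpace ℝ (Fin 3)) 1) :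
    IsSuitableWeakSolutionInBall ρ z v q := by
  have hQR : parabolicCylinder ρ z ⊆ SereginSverak2009.parCyl 0 1 :=
    parabolicCylinder_subset_parCyl_of hI hB
  have hleR : parabolicCylinderOpens ρ z ≤ SereginSverak2009.parCylOpens 0 1 := fun w hw => hQR hw
  refine ⟨hsw.of_le hleR, ?_, ⟨G, hG.mono hleR, (lintegral_mono_set hQR).trans_lt hE⟩, ?_⟩
  · obtain ⟨C, hC⟩ := hA
    refine ⟨C, ?_⟩
    filter_upwards [ae_restrict_of_ae_restrict_of_subset hI hC] with t ht
    exact (lintegral_mono_set hB).trans ht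
  · have hpm : AEStronglyMeasurable (uncurry q) (volume.restrict (parabolicCylinder ρ z)) :=
      hsw.distributional.2.2.1.aestronglyMeasurable.mono_measure
        (Measure.restrict_mono (hQR.trans (subset_of_eq (SereginSverak2009.coe_parCylOpens 0 1).symm))
          le_rfl)
    have hfin : ∫⁻ w in parabolicCylinder ρ z, ‖uncurry q w‖ₑ ^ (3 / 2 : ℝ) ≠ ∞ :=
      ((lintegral_mono_set hQR).trans_lt hq).ne
    exact (memLp_threeHalves_of_lintegral_le hpm hfin le_rfl).1

/-! ### Dissipation concentrates at backward-singular points -/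

/-- The zoom centre: `Φ(0) = z` for `Φ(s, y) = (t + ρ² s, x + ρ y)`. [folklore] -/
theorem stAffine_zero_eq (ρ : ℝ) (z : ℝ × EuclideanSpace ℝ (Fin 3)) :
    stAffine (ρ ^ 2) ρ z.1 z.2 (0 : ℝ × EuclideanSpace ℝ (Fin 3)) = z := by
  ext <;> simp [stAffine]

/-- **Dissipation concentrates at backward-singular points of `𝒞 × ]-1, 0]`** (the backward form
of "otherwise the point would be regular", CKN 1982 §6 / Robinson–Rodrigo–Sadowski 2016, proof
of Thm. 16.2, with Seregin's backward criterion, *Lecture Notes* 2014, Ch. 6, Thm. 1.4, as the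
ε-regularity input — hypothesis `H`, the matrix of `seregin2014_thm14`, proved in the tree as
`seregin2014_thm14_holds`).  For the Def.-1.1 class in `Q = 𝒞 × ]-1, 0[` with weak gradient `G`:
if `z = (t, x)`, `-1 < t ≤ 0`, `x ∈ 𝒞`, and `v` is essentially unbounded on every `Q_r(z)`, then
`(ε/2) · r < ∫∫_{Q_r(z)} |G|²` for arbitrarily small `r > 0`.  Otherwise `E(r; z) ≤ ε/2` for all
`r` below some `ρ` with `Q_ρ(z) ⊆ Q`; the zoom `v_ρ = ρ v ∘ Φ`, `q_ρ = ρ² q ∘ Φ` is in the class on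
`Q_1(0)` (`IsSuitableWeakSolutionInBall.zoom`) with `sup_{0<r<1} E(r; 0) ≤ ε/2 < ε`
(`cknE_nsZoom`), so `H` bounds `v_ρ` on some `Q_ϱ(0)`, i.e. `v` on `Q_{ρϱ}(z)`
(`eLpNorm_top_nsZoom`) — a contradiction.
[cite: CaffarelliKohnNirenberg1982, §6 (proof of Theorem B)] -/
theorem frequently_lt_dissipation_of_backwardSingular {ε : ℝ} (hε : 0 < ε)
    (H : ∀ (v : ℝ → EuclideanSpace ℝ (Fin 3) → EuclideanSpace ℝ (Fin 3))
      (q : ℝ → EuclideanSpace ℝ (Fin 3) → ℝ),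
      IsSuitableWeakSolutionInBall 1 0 v q →
      (∃ G : ℝ → EuclideanSpace ℝ (Fin 3) → EuclideanSpace ℝ (Fin 3) →L[ℝ] EuclideanSpace ℝ (Fin 3),
        HasWeakSpatialGradientOn (parabolicCylinderOpens 1 (0 : ℝ × EuclideanSpace ℝ (Fin 3))) v G ∧
        (⨆ r ∈ Ioo (0 : ℝ) 1, cknE r (0 : ℝ × EuclideanSpace ℝ (Fin 3)) G) < ENNReal.ofReal ε) →
      ∃ ϱ ∈ Ioo (0 : ℝ) 1, eLpNorm (uncurry v) ∞
        (volume.restrict (parabolicCylinder ϱ (0 : ℝ × EuclideanSpace ℝ (Fin 3)))) < ∞)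
    {v : ℝ → EuclideanSpace ℝ (Fin 3) → EuclideanSpace ℝ (Fin 3)} {q : ℝ → EuclideanSpace ℝ (Fin 3) → ℝ}
    {G : ℝ → EuclideanSpace ℝ (Fin 3) → EuclideanSpace ℝ (Fin 3) →L[ℝ] EuclideanSpace ℝ (Fin 3)}
    (hsw : IsSuitableWeakSolutionOn (SereginSverak2009.parCylOpens 0 1) 1 0 v q)
    (hA : ∃ C : ℝ≥0, ∀ᵐ t ∂(volume.restrict (Ioo (-1 : ℝ) 0)),
      ∫⁻ x in SereginSverak2009.spaceCyl 0 1, ‖v t x‖ₑ ^ 2 ≤ C)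
    (hG : HasWeakSpatialGradientOn (SereginSverak2009.parCylOpens 0 1) v G)
    (hE : ∫⁻ z in SereginSverak2009.parCyl 0 1, ENNReal.ofReal (frobeniusNormSq (G z.1 z.2)) < ∞)
    (hq : ∫⁻ z in SereginSverak2009.parCyl 0 1, ‖q z.1 z.2‖ₑ ^ (3 / 2 : ℝ) < ∞)
    {z : ℝ × EuclideanSpace ℝ (Fin 3)} (hz1 : z.1 ∈ Ioc (-1 : ℝ) 0)
    (hz2 : z.2 ∈ SereginSverak2009.spaceCyl (0 : EuclideanSpace ℝ (Fin 3)) 1)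
    (hsing : ¬ ∃ r > 0, eLpNorm (uncurry v) ∞ (volume.restrict (parabolicCylinder r z)) < ∞) :
    ∃ᶠ r in 𝓝[>] (0 : ℝ), ENNReal.ofReal (ε / 2) * ENNReal.ofReal r <
      ∫⁻ w in parabolicCylinder r z, ENNReal.ofReal (frobeniusNormSq (G w.1 w.2)) := by
  by_contra hcon
  rw [Filter.not_frequently] at hcon
  -- an interval `]0, r₁[` of radii with `∫∫_{Q_r(z)} |G|² ≤ (ε/2) r`
  obtain ⟨r₁, hr₁, hsub⟩ := mem_nhdsGT_iff_exists_Ioo_subset.1 hcon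
  have hr₁' : (0 : ℝ) < r₁ := hr₁
  -- a radius `ρ < r₁` with `Q_ρ(z) ⊆ Q`
  obtain ⟨ρ, ⟨hρ, hI, hB⟩, hρr₁⟩ :=
    ((eventually_nhdsGT_window_ball_subset hz1 hz2).and (Ioo_mem_nhdsGT hr₁')).exists
  have hρ2 : 0 < ρ ^ 2 := pow_pos hρ 2
  -- the class on `Q_ρ(z)` and its zoom to `Q_1(0)`
  have hball : IsSuitableWeakSolutionInBall ρ z v q :=
    isSuitableWeakSolutionInBall_of_parCyl hsw hA hG hE hq hI hB
  have hzoom := hball.zoom hρ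
  -- the zoomed gradient
  have hQR : parabolicCylinder ρ z ⊆ SereginSverak2009.parCyl 0 1 :=
    parabolicCylinder_subset_parCyl_of hI hB
  have hleR : parabolicCylinderOpens ρ z ≤ SereginSverak2009.parCylOpens 0 1 := fun w hw => hQR hw
  have hGρ : HasWeakSpatialGradientOn (parabolicCylinderOpens ρ z) v G := hG.mono hleR
  have hG' : HasWeakSpatialGradientOn (parabolicCylinderOpens 1 (0 : ℝ × EuclideanSpace ℝ (Fin 3)))
      (ρ • stPull (ρ ^ 2) ρ z.1 z.2 v) ((ρ ^ 2) • stPull (ρ ^ 2) ρ z.1 z.2 G) := by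
    have h := hGρ.stRescale ρ hρ2 hρ z.1 z.2
    rw [zoom_stPreimage_parabolicCylinderOpens hρ z, ← sq] at h
    exact h
  -- smallness of `E` at all scales `0 < r < 1` of the zoom
  have hEsmall : ∀ r ∈ Ioo (0 : ℝ) 1,
      cknE r (0 : ℝ × EuclideanSpace ℝ (Fin 3)) ((ρ ^ 2) • stPull (ρ ^ 2) ρ z.1 z.2 G) ≤
        ENNReal.ofReal (ε / 2) := by
    intro r hr
    rw [cknE_nsZoom hρ hr.1, stAffine_zero_eq]
    have hρr : 0 < ρ * r := mul_pos hρ hr.1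
    have hρr₁ : ρ * r ∈ Ioo (0 : ℝ) r₁ :=
      ⟨hρr, lt_of_lt_of_le (mul_lt_of_lt_one_right hρ hr.2) hρr₁.2.le⟩
    have hle : ∫⁻ w in parabolicCylinder (ρ * r) z, ENNReal.ofReal (frobeniusNormSq (G w.1 w.2)) ≤
        ENNReal.ofReal (ε / 2) * ENNReal.ofReal (ρ * r) := not_lt.1 (hsub hρr₁)
    have h0 : ENNReal.ofReal (ρ * r) ≠ 0 := (ENNReal.ofReal_pos.2 hρr).ne'
    unfold cknE
    calc (ENNReal.ofReal (ρ * r))⁻¹ *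
          ∫⁻ w in parabolicCylinder (ρ * r) z, ENNReal.ofReal (frobeniusNormSq (G w.1 w.2))
        ≤ (ENNReal.ofReal (ρ * r))⁻¹ * (ENNReal.ofReal (ε / 2) * ENNReal.ofReal (ρ * r)) :=
          mul_le_mul' le_rfl hle
      _ = ENNReal.ofReal (ε / 2) := by
          rw [mul_comm (ENNReal.ofReal (ε / 2)), ← mul_assoc,
            ENNReal.inv_mul_cancel h0 ENNReal.ofReal_ne_top, one_mul]
  have hsup : (⨆ r ∈ Ioo (0 : ℝ) 1,
      cknE r (0 : ℝ × EuclideanSpace ℝ (Fin 3)) ((ρ ^ 2) • stPull (ρ ^ 2) ρ z.1 z.2 G)) <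
        ENNReal.ofReal ε := by
    refine lt_of_le_of_lt (iSup₂_le hEsmall) ?_
    exact (ENNReal.ofReal_lt_ofReal_iff hε).2 (by linarith)
  -- the criterion at the zoomed origin
  obtain ⟨ϱ, hϱ, hfin⟩ := H _ _ hzoom ⟨_, hG', hsup⟩
  rw [eLpNorm_top_nsZoom hρ z.1 z.2 ϱ 0 v, stAffine_zero_eq] at hfin
  refine hsing ⟨ρ * ϱ, mul_pos hρ hϱ.1, ?_⟩
  by_contra htop
  rw [not_lt, top_le_iff] at htop
  rw [htop, ENNReal.mul_top (ENNReal.ofReal_pos.2 hρ).ne'] at hfin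
  exact lt_irrefl _ hfin

/-! ### Partial regularity up to the top time -/

/-- **Seregin 2022, §2 Step 1: the backward-singular set of `𝒞 × ]-1, 0]` is `𝒫¹`-null**
(Caffarelli–Kohn–Nirenberg's Theorem B up to the top time, backward cylinders).  For a suitable
weak solution `(v, q)` of Def. 1.1 in `Q = 𝒞 × ]-1, 0[` — `IsSuitableWeakSolutionOn` on
`SereginSverak2009.parCylOpens 0 1` with `v ∈ L_{2,∞}(Q)`, a weak spatial gradient `G ∈ L₂(Q)`
and `q ∈ L_{3/2}(Q)` — the set of points `z = (t, x)` with `-1 < t ≤ 0`, `x ∈ 𝒞`, at which `v` is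
essentially unbounded on every backward ball cylinder `Q_r(z)`, `r > 0`, has one-dimensional
parabolic Hausdorff measure zero.  (This is the nullity behind "there exist at least two regular
points `z₁ = (0, h₁, 0)` and `z₂ = (0, -h₂, 0)`", arXiv:2201.00153 p. 5, whose points lie on the top
time.)  Proof: dissipation concentrates at such points
(`frequently_lt_dissipation_of_backwardSingular`, from `seregin2014_thm14_holds`), `Q_r(z) ⊆
Q*_r(z) ∩ Q` for small `r`, and the covering step `isParabolicNull_of_frequently` for the
integrable density `𝟙_Q |G|²`. [cite: Seregin2022LocalAxisym, §2 Step 1 (arXiv:2201.00153 p. 5)] -/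
theorem isParabolicNull_backwardSingular_top : ∀ (v : ℝ → EuclideanSpace ℝ (Fin 3) → EuclideanSpace ℝ (Fin 3)) (q : ℝ → EuclideanSpace ℝ (Fin 3) → ℝ) (G : ℝ → EuclideanSpace ℝ (Fin 3) → EuclideanSpace ℝ (Fin 3) →L[ℝ] EuclideanSpace ℝ (Fin 3)), IsSuitableWeakSolutionOn (SereginSverak2009.parCylOpens 0 1) 1 0 v q → (∃ C : ℝ≥0, ∀ᵐ t ∂(volume.restrict (Ioo (-1 : ℝ) 0)), ∫⁻ x in SereginSverak2009.spaceCyl 0 1, ‖v t x‖ₑ ^ 2 ≤ C) → HasWeakSpatialGradientOn (SereginSverak2009.parCylOpens 0 1) v G → (∫⁻ z in SereginSverak2009.parCyl 0 1, ENNReal.ofReal (frobeniusNormSq (G z.1 z.2)) < ∞) → (∫⁻ z in SereginSverak2009.parCyl 0 1, ‖q z.1 z.2‖ₑ ^ (3 / 2 : ℝ) < ∞) → IsParabolicNull 1 {z : ℝ × EuclideanSpace ℝ (Fin 3) | z.1 ∈ Ioc (-1 : ℝ) 0 ∧ z.2 ∈ SereginSverak2009.spaceCyl 0 1 ∧ ¬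 ∃ r > 0, eLpNorm (uncurry v) ∞ (volume.restrict (parabolicCylinder r z)) < ∞} := by
  intro v q G hsw hA hG hE hq
  obtain ⟨ε, hε, H⟩ := seregin2014_thm14_holds
  -- the integrable density `F = 𝟙_Q |G|²`
  set f : ℝ × EuclideanSpace ℝ (Fin 3) → ℝ≥0∞ :=
    fun w => ENNReal.ofReal (frobeniusNormSq (G w.1 w.2)) with hf
  have hQm : MeasurableSet (SereginSverak2009.parCyl (0 : ℝ × EuclideanSpace ℝ (Fin 3)) 1) :=
    (SereginSverak2009.isOpen_parCyl 0 1).measurableSet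
  set F : ℝ × EuclideanSpace ℝ (Fin 3) → ℝ≥0∞ :=
    (SereginSverak2009.parCyl (0 : ℝ × EuclideanSpace ℝ (Fin 3)) 1).indicator f with hF
  have hFint : ∫⁻ w, F w ≠ ∞ := by
    rw [hF, lintegral_indicator hQm]
    exact hE.ne
  -- the concentration level `l = ε/2`
  have hl0 : ENNReal.ofReal (ε / 2) ≠ 0 := (ENNReal.ofReal_pos.2 (by positivity)).ne'
  refine isParabolicNull_of_frequently hFint hl0 ENNReal.ofReal_ne_top fun z hz => ?_
  obtain ⟨hz1, hz2, hsing⟩ := hz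
  have hfreq := frequently_lt_dissipation_of_backwardSingular hε H hsw hA hG hE hq hz1 hz2 hsing
  refine hfreq.mp ?_
  filter_upwards [eventually_nhdsGT_window_ball_subset hz1 hz2] with r hr hlt
  obtain ⟨-, hI, hB⟩ := hr
  have hQR : parabolicCylinder r z ⊆ SereginSverak2009.parCyl 0 1 :=
    parabolicCylinder_subset_parCyl_of hI hB
  refine hlt.trans_le ?_
  calc ∫⁻ w in parabolicCylinder r z, f w
      ≤ ∫⁻ w in SereginSverak2009.parCyl 0 1 ∩ parabolicCylinderCentered r z, f w :=
        lintegral_mono_set (subset_inter hQR (parabolicCylinder_subset_centered r z))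
    _ = ∫⁻ w in parabolicCylinderCentered r z, F w := by
        rw [hF, lintegral_indicator hQm, Measure.restrict_restrict hQm]

end Summit.NavierStokesRegularity.NavierStokesRegularity.Theorems.AxisymmetricKatoGlobal.EulerScaling

end
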